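import Literature.AlgebraicGeometry.Motives.TateConjectureDominatedVarieties
import HarnessLib

/-!
# The Hodge conjecture descends to dominated varieties
(Kleiman 1968 Prop. 1.2.4; Voisin 2002 §7.3.2, §11.3)

Let `B` be a Betti–Hodge realization datum (the tree's `BettiHodgeData k`: a Weil cohomology
theory `B.W` with `ℚ`-coefficients carrying functorial polarizable Hodge structures `B.hodge hX i`
on `Hⁱ(X)` for smooth projective `X`, with pull-backs morphisms of Hodge structures
`B.pullback_hom` — Voisin, *Hodge Theory I*, §7.3.2) and `B.HodgeConjectureFor hX p` the Hodge
conjecture `ℚ · Aᵖ(X) = Hdgᵖ(X)` for `(X, p)` relative to `B` (Voisin I, Conj. 11.24).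

For `f : V ⟶ U` (`dim V = dim U + r`) and a rational algebraic class `ζ ∈ Aʳ(V)_ℚ` with
`f₊ ζ ≠ 0` (`U` dominated by `V`, Kleiman 1968 Prop. 1.2.4; this lane's
`StandardConjecturesDominatedVarieties`, `TateConjectureDominatedVarieties`):

* Hodge classes pull back to Hodge classes (`pullback_mem_hodgeClasses`; morphisms of Hodge
  structures preserve `F^p`, Voisin I §7.3.2);
* **`HC(V, p) ⇒ HC(U, p)`** (`hodgeConjectureFor_of_pushforward_ne_zero`): a Hodge class `x` on
  `U` pulls back to a Hodge class on `V`, algebraic by `HC(V, p)`, and algebraicity descends along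
  `(f, ζ)` (`mem_algebraicClasses_of_pullback_mem`: `x = q⁻¹ f₊ (f* x ∪ ζ)`);
* the cases of a morphism of non-zero degree (`hodgeConjectureFor_of_pullback_top_ne_zero`:
  isogenies, finite quotient maps) and of the factors of a product
  (`hodgeConjectureFor_of_tensor_left/right`: **`HC(X × Z, p) ⇒ HC(X, p)`, `HC(Z, p)`**).

The summit-side twin for complex varieties and surjective morphisms (Betti cohomology of `X(ℂ)`,
`HodgeTheory.HodgeConjectureFor`) is `HodgeTheory/ProductFactorsHodgeDescent` and
`HodgeTheory/HodgeConjectureDescendsAlongSurjections` (Voisin I, Lemma 7.28; Arapura 2006,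
Lemma 4.2); the present file is the statement for an abstract Betti–Hodge realization datum over
any `k ⊆ ℂ`, with domination witnessed by an algebraic class instead of surjectivity.
Theorems only; no new definitions, no named facts.

## References

* [VoisinHodgeI2002] C. Voisin, *Hodge Theory and Complex Algebraic Geometry I*, CUP (2002),
  §7.3.2 (functoriality), §11.3 (cycle class, Conj. 11.24).
* [Kleiman1968AlgebraicCycles] S. Kleiman, *Algebraic cycles and the Weil conjectures*, in: Dix
  exposés sur la cohomologie des schémas (1968), §1.2 Prop. 1.2.4, §1.3.
-/

universe u v

open CategoryTheory AlgebraicGeometry MonoidalCategory CartesianMonoidalCategory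
open scoped TensorProduct

noncomputable section

namespace Literature.AlgebraicGeometry.Motives

namespace HodgeStructure

variable {V : Type u} [AddCommGroup V] [Module ℚ V] {V' : Type v} [AddCommGroup V'] [Module ℚ V']

/-- A morphism of pure Hodge structures maps rational classes in `Fᵖ` to rational classes in `Fᵖ`
(`φ_ℂ (1 ⊗ v) = 1 ⊗ φ v`, `φ_ℂ (Fᵖ) ⊆ Fᵖ`). Local copy of the tree's
`HodgeStructure.Hom.apply_mem_hodgeClasses` (`MixedHodgeStructureLerayAssembly`), kept here to
avoid that import. [folklore] -/
private theorem Hom.apply_mem_hodgeClasses_aux {n : ℤ} {H₁ : HodgeStructure V n}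
    {H₂ : HodgeStructure V' n} (φ : Hom H₁ H₂) {p : ℤ} {v : V} (hv : v ∈ H₁.hodgeClasses p) :
    φ.toLinearMap v ∈ H₂.hodgeClasses p := by
  rw [mem_hodgeClasses_iff] at hv ⊢
  have h : φ.toLinearMap.baseChange ℂ (ofRat v) = ofRat (φ.toLinearMap v) := by
    rw [ofRat_apply, ofRat_apply, LinearMap.baseChange_tmul]
  rw [← h]
  exact φ.map_F_le p ⟨_, hv, rfl⟩

end HodgeStructure

namespace BettiHodgeData

variable {k : Type} [Field k] [Algebra k ℂ] (B : BettiHodgeData k)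
variable {N M n m r : ℕ} {V U X Z : SchemeOver k}

/-! ## Hodge classes pull back to Hodge classes -/

/-- **`f*` maps Hodge classes to Hodge classes**: for `f : V ⟶ U` of smooth projective varieties
and `x ∈ Hⁱ(U) ∩ Fᵖ`, `f* x ∈ Hⁱ(V) ∩ Fᵖ` (`f*` is a morphism of Hodge structures,
`B.pullback_hom`; Voisin I §7.3.2). [cite: VoisinHodgeI2002, §7.3.2] -/
theorem pullback_mem_hodgeClasses (hV : IsSmoothProjective N V) (hU : IsSmoothProjective M U)
    (f : V ⟶ U) {i : ℕ} {p : ℤ} {x : B.W.obj U i} (hx : x ∈ (B.hodge hU i).hodgeClasses p) :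
    B.W.pullback f i x ∈ (B.hodge hV i).hodgeClasses p := by
  obtain ⟨φ, hφ⟩ := B.pullback_hom hV hU f i
  rw [← hφ]
  exact φ.apply_mem_hodgeClasses_aux hx

/-! ## The Hodge conjecture descends -/

/-- **`HC(V, p) ⇒ HC(U, p)` for `U` dominated by `V`**: `f : V ⟶ U`, `dim V = dim U + r`,
`f₊ ζ ≠ 0` for some `ζ ∈ Aʳ(V)_ℚ` (Kleiman 1968 Prop. 1.2.4; e.g. `f` surjective with a generically
finite multisection). A Hodge class `x ∈ Hdgᵖ(U)` pulls back to `f* x ∈ Hdgᵖ(V) = ℚ · Aᵖ(V)`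
(`pullback_mem_hodgeClasses`, `HC(V, p)`), and `x = q⁻¹ f₊ (f* x ∪ ζ) ∈ ℚ · Aᵖ(U)`
(`mem_algebraicClasses_of_pullback_mem`); with the easy inclusion `algebraicClasses_le_hodgeClasses`
(Voisin I, Prop. 11.20). [cite: VoisinHodgeI2002, §11.3 Conj. 11.24] [cite: Kleiman1968AlgebraicCycles, §1.2 Prop. 1.2.4] -/
theorem hodgeConjectureFor_of_pushforward_ne_zero (hV : IsSmoothProjective N V)
    (hU : IsSmoothProjective M U) (f : V ⟶ U) {ζ : B.W.obj V (2 * r)}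
    (hζ : ζ ∈ B.W.ratAlgebraicClasses V r) {he : 2 * r + 2 * M = 2 * N} {hd : 0 + 2 * M = 2 * M}
    (hne : B.W.pushforward (N := N) hU f he hd ζ ≠ 0) {p : ℕ} (hH : B.HodgeConjectureFor hV p) :
    B.HodgeConjectureFor hU p := by
  rw [B.hodgeConjectureFor_iff]
  intro x hx
  refine B.W.mem_algebraicClasses_of_pullback_mem hV hU f hζ hne ?_
  rw [show B.W.algebraicClasses V p = (B.hodge hV (2 * p)).hodgeClasses p from hH]
  exact B.pullback_mem_hodgeClasses hV hU f hx

/-- **`HC(V, p) ⇒ HC(U, p)` along a morphism of non-zero degree** (`V`, `U` of the same dimension,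
`f* ≠ 0` on `H²ᴺ(U)`: the case `ζ = 1` — isogenies of abelian varieties, finite quotient maps).
[cite: VoisinHodgeI2002, §11.3 Conj. 11.24] [cite: Kleiman1968AlgebraicCycles, §1.2 Prop. 1.2.4] -/
theorem hodgeConjectureFor_of_pullback_top_ne_zero (hV : IsSmoothProjective N V)
    (hU : IsSmoothProjective N U) (f : V ⟶ U) (hf : B.W.pullback f (2 * N) ≠ 0) {p : ℕ}
    (hH : B.HodgeConjectureFor hV p) : B.HodgeConjectureFor hU p := by
  have h0 : 0 + 2 * N = 2 * N := Nat.zero_add _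
  have hne : B.W.pushforward (N := N) hU f h0 h0 (B.W.one V) ≠ 0 :=
    fun h ↦ hf ((B.W.pushforward_one_eq_zero_iff hV hU f h0).mp h)
  exact B.hodgeConjectureFor_of_pushforward_ne_zero hV hU f (r := 0)
    (B.W.one_mem_ratAlgebraicClasses hV) (he := by omega) (hd := h0) hne hH

/-- **`HC(X × Z, p) ⇒ HC(X, p)`** for all smooth projective `X`, `Z` (`X` is dominated by `X × Z`
through `(pr_X, pr_Z^* b)`, `exists_pushforward_fst_ne_zero`). The Hodge structure on `X × Z` may
be given by any smoothness witness `hXZ`. [cite: VoisinHodgeI2002, §11.3 Conj. 11.24] -/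
theorem hodgeConjectureFor_of_tensor_left (hX : IsSmoothProjective n X) (hZ : IsSmoothProjective m Z)
    (hXZ : IsSmoothProjective (n + m) (X ⊗ Z)) {p : ℕ} (hH : B.HodgeConjectureFor hXZ p) :
    B.HodgeConjectureFor hX p := by
  obtain ⟨ζ, hζ, hne⟩ := B.W.exists_pushforward_fst_ne_zero hX hZ
    (by omega : 2 * m + 2 * n = 2 * (n + m)) (Nat.zero_add _)
  exact B.hodgeConjectureFor_of_pushforward_ne_zero hXZ hX (fst X Z) hζ hne hH

/-- **`HC(X × Z, p) ⇒ HC(Z, p)`** (`Z` is dominated by `X × Z` through `(pr_Z, pr_X^* a)`,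
`exists_pushforward_snd_ne_zero`). [cite: VoisinHodgeI2002, §11.3 Conj. 11.24] -/
theorem hodgeConjectureFor_of_tensor_right (hX : IsSmoothProjective n X)
    (hZ : IsSmoothProjective m Z) (hXZ : IsSmoothProjective (n + m) (X ⊗ Z)) {p : ℕ}
    (hH : B.HodgeConjectureFor hXZ p) : B.HodgeConjectureFor hZ p := by
  obtain ⟨ζ, hζ, hne⟩ := B.W.exists_pushforward_snd_ne_zero hX hZ
    (by omega : 2 * n + 2 * m = 2 * (n + m)) (Nat.zero_add _)
  exact B.hodgeConjectureFor_of_pushforward_ne_zero hXZ hZ (snd X Z) hζ hne hH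

/-- **`HC` for all codimensions descends to dominated varieties**: if `V` satisfies the Hodge
conjecture in every codimension then so does every `U` dominated by `V`.
[cite: VoisinHodgeI2002, §11.3 Conj. 11.24] [cite: Kleiman1968AlgebraicCycles, §1.2 Prop. 1.2.4] -/
theorem forall_hodgeConjectureFor_of_pushforward_ne_zero (hV : IsSmoothProjective N V)
    (hU : IsSmoothProjective M U) (f : V ⟶ U) {ζ : B.W.obj V (2 * r)}
    (hζ : ζ ∈ B.W.ratAlgebraicClasses V r) {he : 2 * r + 2 * M = 2 * N} {hd : 0 + 2 * M = 2 * M}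
    (hne : B.W.pushforward (N := N) hU f he hd ζ ≠ 0) (hH : ∀ p : ℕ, B.HodgeConjectureFor hV p)
    (p : ℕ) : B.HodgeConjectureFor hU p :=
  B.hodgeConjectureFor_of_pushforward_ne_zero hV hU f hζ hne (hH p)

end BettiHodgeData

end Literature.AlgebraicGeometry.Motives

end
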